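import Summits.AnomalousDissipation.AnomalousDissipation.Theses.TwoAndHalfD
import Summits.AnomalousDissipation.AnomalousDissipation.Theorems.TwoAndHalfDScalarLiftRecord
import Literature.Analysis.FluidPDE.DoeringFoiasProofs
import Literature.Analysis.FluidPDE.TwoHalfSpectralSplit
import Literature.Analysis.FluidPDE.TwoHalfSection
import Literature.Analysis.FluidPDE.TwoHalfWeakEuler
import Literature.Analysis.FluidPDE.LongTimeAverageSubadditive
import Literature.Analysis.FluidPDE.NSStrongSolutions2D
import HarnessLib

/-!
# Route TwoAndHalfD — the crux-to-target glue `ScalarLiftGlue`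

Item `stmt-AnomalousDissipation-14325` (support, rank 9) of route
`route-AnomalousDissipation-TwoAndHalfD`:
`ScalarAnomalySteadySourceFormal → SourcedScalarUnique2D → ScalarLift2halfD → TwohalfdThesis`.

## The argument (measure-theoretic bookkeeping, no PDE)

Take the witness `(g, h, ν, v₀, v, θ₀, θ, E_v, E_θ, ε)` of `ScalarAnomalySteadySourceFormal`.
For each `j`, `ScalarLift2halfD` provides the energy representative `θ̃ⱼ` of the sourced scalar
together with the fact that the `2½`-dimensional lift `uⱼ(t) = (vⱼ(t), θ̃ⱼ(t)) ∘ π`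
(`Torus.twoHalf`) is a global Leray–Hopf solution on `T³` forced by `f = (g, h) ∘ π` from
`(v₀ⱼ, θ₀ⱼ) ∘ π`; `SourcedScalarUnique2D` gives `θ̃ⱼ(t) = θⱼ(t)` a.e. in `x` for a.e. `t ∈ (0,T)`,
every `T > 0`. The witness of `TwohalfdThesis` is `(f, ν, (v₀ⱼ,θ₀ⱼ)∘π, uⱼ)`:

* `f` is `x₃`-invariant, smooth, divergence free and mean zero (`Torus.twoHalf_add_single`,
  `IsSmooth.twoHalf`, `IsDivFree.twoHalf`, `hasZeroMean_twoHalf`), and so is every `uⱼ(t)`.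
* **Mean energy.** For `t ≥ 0` all slices are in `L²`, so `‖uⱼ(t)‖² = ‖vⱼ(t)‖² + ‖θ̃ⱼ(t)‖²`
  (`integral_norm_sq_twoHalf_of_memLp`), and `‖θ̃ⱼ(t)‖² = ‖θⱼ(t)‖²` for a.e. `t`; the three
  energies are integrable on every `(0,T]` (`IsGlobalLerayHopf.integrableOn_integral_norm_sq`), so
  the running means of `‖uⱼ‖²` are those of `‖vⱼ‖² + ‖θⱼ‖²`. The bound
  `⟨‖vⱼ‖² + ‖θⱼ‖²⟩ ≤ E_v + E_θ` is *junk-robust* (`longTimeAvgSup_add_le_add`): if the running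
  means of a summand are unbounded, so are those of the sum, whose real `limsup` is then the junk
  value `0 ≤ E_v + E_θ` (both constants dominate `limsup`s of nonnegative means, hence are `≥ 0`).
* **Mean dissipation.** For a.e. `t`, `‖∇uⱼ(t)‖₂² = ‖∇vⱼ(t)‖₂² + ‖∇θ̃ⱼ(t)‖₂² < ∞` spectrally
  (`Torus.eGradNormSq_twoHalf`, finiteness from `u ∈ L²H¹`), and `‖∇θ̃ⱼ(t)‖₂² = ‖∇θⱼ(t)‖₂²`
  (same Fourier coefficients, `eHomSobolevSeminorm_congr_ae`), whence
  `νⱼ‖∇θⱼ(t)‖₂² ≤ νⱼ‖∇uⱼ(t)‖₂²` a.e. and the same for the running means (the dissipation of the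
  lift is integrable in time, `Torus.IsLerayHopfOn.intervalIntegral_dissipation_eq`). The crucial
  point is that the running means of `νⱼ‖∇uⱼ‖₂²` are **bounded** — otherwise `meanDissipation`
  would be the junk `0`: this is the Doering–Foias a-priori bound
  `∫₀ᵀ ν‖∇u‖₂² ≤ ‖u₀‖₂² + T‖f‖₂²/(4π²ν)` for a steady *mean-zero* force
  (`Torus.IsLerayHopfOn.intervalIntegral_power_bounds`, energy inequality + spectral
  Poincaré–Young). Then `ε ≤ ⟨νⱼ‖∇θⱼ‖₂²⟩ ≤ ⟨νⱼ‖∇uⱼ‖₂²⟩ = meanDissipation νⱼ uⱼ`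
  (`Filter.limsup_le_limsup`).

## Status (route rev 9, 2026-08-16)

The route dropped `ScalarLift2halfD` (stmt-AnomalousDissipation-14324, refuted as misstated by
`Theorems.not_ScalarLift2halfD`: unconstrained junk planar datum) and with it this item
`ScalarLiftGlue` (proved below, now vacuous); the repaired chain is `ScalarLift2halfDR` /
`ScalarLiftGlueR` (`Theorems/TwoAndHalfDScalarLiftGlueR.lean`, which reuses the bookkeeping lemmas of
this file). The two dropped constants are re-declared verbatim by the record module
`Theorems/TwoAndHalfDScalarLiftRecord.lean`, imported above so that this proof record elaborates.

## References

* E. Bruè, C. De Lellis, *Anomalous dissipation for the forced 3D Navier–Stokes equations*,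
  Comm. Math. Phys. 400 (2023), §3 (the `2½`-dimensional architecture).
* A. Cheskidov, *Dissipation anomaly and anomalous dissipation in incompressible fluid flows*,
  arXiv:2311.04182 (2023), Lemma 3.2 and §6 p. 19 (`‖∇u‖² = ‖∇v‖² + ‖∇θ‖²`).
* C. R. Doering, C. Foias, *Energy dissipation in body-forced turbulence*, J. Fluid Mech. 467
  (2002), §2 (long-time averages; a-priori bounds on the running means).
-/

noncomputable section

open MeasureTheory Set Filter Topology Function
open scoped ENNReal NNReal InnerProductSpace
open Literature.Analysis.FunctionSpaces Literature.Analysis.FunctionSpaces.Torus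
open Literature.Analysis.FluidPDE Literature.Analysis.FluidPDE.Torus

namespace Summit.AnomalousDissipation.AnomalousDissipation.Theorems

-- D-0017: single-problem summit ⇒ `Summit.AnomalousDissipation.AnomalousDissipation.…` by design.
set_option linter.dupNamespace false

/-! ### Junk-robust bookkeeping for real `limsup`s of running means -/

/-- A real `limsup` along `atTop` of a family which is **not** eventually bounded above is the
junk value `0` (`Filter.limsup u atTop = sInf ∅ = 0`, Mathlib's `Real.sInf_empty`); local copy of
the bookkeeping lemma of `Literature/Analysis/FluidPDE/LongTimeAverageShift`. [folklore] -/
private theorem limsup_eq_zero_of_not_isBoundedUnder {u : ℝ → ℝ}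
    (h : ¬ IsBoundedUnder (· ≤ ·) atTop u) : limsup u atTop = 0 := by
  rw [Filter.limsup_eq]
  have he : {a : ℝ | ∀ᶠ T in atTop, u T ≤ a} = ∅ := by
    ext b
    simp only [Set.mem_setOf_eq, Set.mem_empty_iff_false, iff_false]
    intro hb
    exact h ⟨b, hb⟩
  rw [he, Real.sInf_empty]

/-- **Junk-robust subadditivity of long-time averages against constants.** For nonnegative
observables `f, g`, integrable on every `(0, T]`, with `⟨f⟩ ≤ A` and `⟨g⟩ ≤ B`, one has
`⟨f + g⟩ ≤ A + B` — whether or not the running means are bounded: if those of the sum are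
bounded, so are those of the summands (`isBoundedUnder_timeMean_of_le`) and Mathlib's
`limsup_add_le` applies (`longTimeAvgSup_add_le`); otherwise `⟨f + g⟩` is the junk value `0`
(`limsup_eq_zero_of_not_isBoundedUnder`), while `A, B ≥ 0` because they dominate `limsup`s of
nonnegative means (`longTimeAvgSup_nonneg`) (Doering–Foias 2002, §2 bookkeeping). [folklore] -/
theorem longTimeAvgSup_add_le_add {f g : ℝ → ℝ} {A B : ℝ} (hf0 : ∀ t, 0 ≤ f t)
    (hg0 : ∀ t, 0 ≤ g t) (hfi : ∀ T, 0 < T → IntegrableOn f (Ioc 0 T))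
    (hgi : ∀ T, 0 < T → IntegrableOn g (Ioc 0 T)) (hA : longTimeAvgSup f ≤ A)
    (hB : longTimeAvgSup g ≤ B) :
    longTimeAvgSup (fun t => f t + g t) ≤ A + B := by
  have hA0 : 0 ≤ A := (longTimeAvgSup_nonneg hf0).trans hA
  have hB0 : 0 ≤ B := (longTimeAvgSup_nonneg hg0).trans hB
  have hdom : ∀ u : ℝ → ℝ, (∀ t, 0 < t → u t ≤ f t + g t) →
      IsBoundedUnder (· ≤ ·) atTop (timeMean fun t => f t + g t) →
      IsBoundedUnder (· ≤ ·) atTop (timeMean u) := fun u hle hb =>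
    isBoundedUnder_timeMean_of_le (fun t => add_nonneg (hf0 t) (hg0 t))
      (fun T hT => (hfi T hT).add (hgi T hT)) hle hb
  by_cases hsum : IsBoundedUnder (· ≤ ·) atTop (timeMean fun t => f t + g t)
  · have hfb := hdom f (fun t _ => le_add_of_nonneg_right (hg0 t)) hsum
    have hgb := hdom g (fun t _ => le_add_of_nonneg_left (hf0 t)) hsum
    exact (longTimeAvgSup_add_le hf0 hg0 hfi hgi hfb hgb).trans (add_le_add hA hB)
  · have h0 : longTimeAvgSup (fun t => f t + g t) = 0 :=
      limsup_eq_zero_of_not_isBoundedUnder hsum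
    rw [h0]
    exact add_nonneg hA0 hB0

/-- **a.e. monotonicity of the running means**: if `u ≤ g` a.e. on `(0, T]` with `g ≥ 0`
integrable on `(0, T]`, then `T⁻¹∫₀ᵀ u ≤ T⁻¹∫₀ᵀ g` for `T ≥ 0` — whether or not `u` is
integrable (a non-integrable `u` has the junk mean `0 ≤ T⁻¹∫₀ᵀ g`). [folklore] -/
theorem timeMean_mono_ae {u g : ℝ → ℝ} {T : ℝ} (hT : 0 ≤ T) (hg0 : ∀ t, 0 ≤ g t)
    (hg : IntegrableOn g (Ioc 0 T)) (hle : ∀ᵐ t ∂(volume.restrict (Ioc 0 T)), u t ≤ g t) :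
    timeMean u T ≤ timeMean g T := by
  by_cases hu : IntegrableOn u (Ioc 0 T)
  · unfold timeMean
    rw [intervalIntegral.integral_of_le hT, intervalIntegral.integral_of_le hT]
    exact mul_le_mul_of_nonneg_left (integral_mono_ae hu hg hle) (inv_nonneg.2 hT)
  · have h0 : timeMean u T = 0 := by
      unfold timeMean
      rw [intervalIntegral.integral_of_le hT, integral_undef hu, mul_zero]
    rw [h0]
    exact timeMean_nonneg hg0 hT

/-- Running means only see the a.e.-class of the observable on `(0, T]`. [folklore] -/
theorem timeMean_congr_ae {u g : ℝ → ℝ} {T : ℝ} (hT : 0 ≤ T)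
    (h : ∀ᵐ t ∂(volume.restrict (Ioc 0 T)), u t = g t) : timeMean u T = timeMean g T := by
  unfold timeMean
  rw [intervalIntegral.integral_of_le hT, intervalIntegral.integral_of_le hT, integral_congr_ae h]

/-- a.e.-equal real scalars on `T^d` have the same spectral dissipation `‖∇θ‖₂²`
(same Fourier coefficients, `eHomSobolevSeminorm_congr_ae`). [folklore] -/
theorem eScalarGradNormSq_congr_ae {d : Type*} [Fintype d] {θ₁ θ₂ : UnitAddTorus d → ℝ}
    (h : θ₁ =ᵐ[volume] θ₂) : eScalarGradNormSq θ₁ = eScalarGradNormSq θ₂ := by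
  unfold eScalarGradNormSq
  have h' : (fun x => (θ₁ x : ℂ)) =ᵐ[volume] fun x => (θ₂ x : ℂ) := by
    filter_upwards [h] with x hx
    rw [hx]
  rw [eHomSobolevSeminorm_congr_ae 1 h']

/-- a.e.-equal real scalars on `T^d` have the same squared `L²` norm. [folklore] -/
theorem scalarL2Sq_congr_ae {d : Type*} [Fintype d] {θ₁ θ₂ : UnitAddTorus d → ℝ}
    (h : θ₁ =ᵐ[volume] θ₂) : scalarL2Sq θ₁ = scalarL2Sq θ₂ := by
  unfold scalarL2Sq
  refine integral_congr_ae ?_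
  filter_upwards [h] with x hx
  rw [hx]

/-! ### The glue -/

/-- **Item `stmt-AnomalousDissipation-14325` (`ScalarLiftGlue`).** The crux
`ScalarAnomalySteadySourceFormal` (anomalous dissipation of a steadily sourced passive scalar over
steadily forced 2-D Leray–Hopf turbulence, with bounded mean energies), together with the two
support statements `SourcedScalarUnique2D` (uniqueness of weak sourced scalars over a 2-D
Leray–Hopf drift) and `ScalarLift2halfD` (the energy representative lifts to a 3-D global
Leray–Hopf solution `(v, θ) ∘ π` forced by `(g, h) ∘ π`), implies the target `TwohalfdThesis`
(the zeroth law inside the `x₃`-invariant class). Proof: see the module docstring — the witness is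
the `2½`-dimensional lift; the mean energy splits and is bounded junk-robustly, and the mean
dissipation of the lift dominates that of the scalar because the running means of the lift's
dissipation are bounded (Doering–Foias a-priori bound for a steady mean-zero force). -/
theorem scalarLiftGlue_proof :
    Summit.AnomalousDissipation.AnomalousDissipation.Theses.TwoAndHalfD.ScalarLiftGlue := by
  unfold Theses.TwoAndHalfD.ScalarLiftGlue
  intro hA hU hL
  obtain ⟨g, h, hg, hgd, hg0, hh, hh0, ν, v₀, v, θ₀, θ, hν, hν0, hLHv, hθ₀, hθW, ⟨Ev, hEv⟩,
    ⟨Eθ, hEθ⟩, ε, hε, hεle⟩ := hA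
  -- the energy representatives `θ' j` of the sourced scalars and their `2½`-dimensional lifts
  choose θ' hθ'W hθ'LH using
    fun j => hL (ν j) g h (v₀ j) (v j) (θ₀ j) (hν j) hg hgd hh (hθ₀ j) (hLHv j)
  -- the force
  have hfs : IsSmooth (twoHalf g h) := hg.twoHalf hh
  have hfd : IsDivFree (twoHalf g h) := hgd.twoHalf h
  have hfm : HasZeroMean (twoHalf g h) := hasZeroMean_twoHalf hg.integrable hh.integrable hg0 hh0
  have hf2 : MemLp (twoHalf g h) 2 volume := hfs.memLp 2
  -- uniqueness: the representative agrees with the crux scalar for a.e. `t ∈ (0, T]`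
  have hae : ∀ j T, 0 < T → ∀ᵐ t ∂(volume.restrict (Ioc 0 T)), θ' j t =ᵐ[volume] θ j t := by
    intro j T hT
    rw [← restrict_Ioo_eq_restrict_Ioc]
    exact hU T (ν j) g h (v₀ j) (v j) (θ₀ j) (θ' j) (θ j) (hν j) (hLHv j) (hθ'W j T hT) (hθW j T hT)
  -- `L²` slices for `t ≥ 0`
  have hv2 : ∀ j t, 0 ≤ t → MemLp (v j t) 2 volume := fun j t ht => (hLHv j).memLp_two ht
  have hθ'2 : ∀ j t, 0 ≤ t → MemLp (θ' j t) 2 volume := fun j t ht =>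
    (memLp_of_twoHalf ((hθ'LH j).memLp_two ht)).2
  refine ⟨twoHalf g h, fun s x => twoHalf_add_single g h s x, hfs, hfd, hfm, ν,
    fun j => twoHalf (v₀ j) (θ₀ j), fun j t => twoHalf (v j t) (θ' j t), hν, hν0, hθ'LH,
    fun j t s x => twoHalf_add_single _ _ s x, ⟨Ev + Eθ, fun j => ?_⟩, ⟨ε, hε, fun j => ?_⟩⟩
  · /- MEAN ENERGY: `⟨‖uⱼ‖²⟩ = ⟨‖vⱼ‖² + ‖θⱼ‖²⟩ ≤ E_v + E_θ` (junk-robust). -/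
    have hLHu := hθ'LH j
    -- pointwise splitting of the energy for `t ≥ 0`
    have hsplit : ∀ t, 0 ≤ t → ∫ x, ‖twoHalf (v j t) (θ' j t) x‖ ^ 2 =
        (∫ y, ‖v j t y‖ ^ 2) + scalarL2Sq (θ' j t) := fun t ht =>
      integral_norm_sq_twoHalf_of_memLp (hv2 j t ht) (hθ'2 j t ht)
    -- a.e. in time the representative and the crux scalar have the same `L²` norm
    have haeE : ∀ T, 0 < T → ∀ᵐ t ∂(volume.restrict (Ioc 0 T)),
        scalarL2Sq (θ' j t) = scalarL2Sq (θ j t) := fun T hT =>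
      (hae j T hT).mono fun t ht => scalarL2Sq_congr_ae ht
    -- integrability in time of the three energies
    have hUi : ∀ T, 0 < T →
        IntegrableOn (fun t => ∫ x, ‖twoHalf (v j t) (θ' j t) x‖ ^ 2) (Ioc 0 T) :=
      fun T hT => hLHu.integrableOn_integral_norm_sq hT
    have hAi : ∀ T, 0 < T → IntegrableOn (fun t => ∫ y, ‖v j t y‖ ^ 2) (Ioc 0 T) :=
      fun T hT => (hLHv j).integrableOn_integral_norm_sq hT
    have hBi : ∀ T, 0 < T → IntegrableOn (fun t => scalarL2Sq (θ j t)) (Ioc 0 T) := by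
      intro T hT
      have h1 : IntegrableOn
          (fun t => (∫ x, ‖twoHalf (v j t) (θ' j t) x‖ ^ 2) - ∫ y, ‖v j t y‖ ^ 2) (Ioc 0 T) :=
        (hUi T hT).sub (hAi T hT)
      refine Integrable.congr h1 ?_
      filter_upwards [haeE T hT, ae_restrict_mem measurableSet_Ioc] with t ht htmem
      rw [hsplit t htmem.1.le, ← ht]
      ring
    -- the running means of `‖uⱼ‖²` are those of `‖vⱼ‖² + ‖θⱼ‖²`
    have hmean : timeMean (fun t => ∫ x, ‖twoHalf (v j t) (θ' j t) x‖ ^ 2) =ᶠ[atTop]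
        timeMean (fun t => (∫ y, ‖v j t y‖ ^ 2) + scalarL2Sq (θ j t)) := by
      filter_upwards [eventually_gt_atTop (0 : ℝ)] with T hT
      refine timeMean_congr_ae hT.le ?_
      filter_upwards [haeE T hT, ae_restrict_mem measurableSet_Ioc] with t ht htmem
      rw [hsplit t htmem.1.le, ht]
    rw [meanEnergy_eq_longTimeAvgSup, longTimeAvgSup, limsup_congr hmean]
    exact longTimeAvgSup_add_le_add (fun t => integral_nonneg fun _ => sq_nonneg _)
      (fun t => scalarL2Sq_nonneg _) hAi hBi (hEv j) (hEθ j)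
  · /- MEAN DISSIPATION: `ε ≤ ⟨νⱼ‖∇θⱼ‖₂²⟩ ≤ ⟨νⱼ‖∇uⱼ‖₂²⟩`, the right-hand running means being
    bounded by the Doering–Foias a-priori bound. -/
    have hLHu := hθ'LH j
    set F : ℝ → ℝ := fun t => ν j * (eGradNormSq (twoHalf (v j t) (θ' j t))).toReal with hF
    set G : ℝ → ℝ := fun t => ν j * (eScalarGradNormSq (θ j t)).toReal with hG
    have hF0 : ∀ t, 0 ≤ F t := fun t => mul_nonneg (hν j).le ENNReal.toReal_nonneg
    have hG0 : ∀ t, 0 ≤ G t := fun t => mul_nonneg (hν j).le ENNReal.toReal_nonneg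
    -- the lift's dissipation is integrable on every `(0, T]` …
    have hFi : ∀ T, 0 < T → IntegrableOn F (Ioc 0 T) := fun T hT =>
      (intervalIntegrable_iff_integrableOn_Ioc_of_le hT.le).1
        ((hLHu T hT).intervalIntegral_dissipation_eq hT).1
    -- … with running means bounded (Doering–Foias: steady mean-zero force)
    have hFb : IsBoundedUnder (· ≤ ·) atTop (timeMean F) := by
      refine isBoundedUnder_timeMean_of_setIntegral_le_linear
        (A := 2 * kineticEnergy (twoHalf (v₀ j) (θ₀ j)))
        (B := 2 * ((4 * Real.pi ^ 2 * ν j)⁻¹ / 2 * ∫ x, ‖twoHalf g h x‖ ^ 2)) fun T hT => ?_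
      have h1 := ((hLHu T hT).intervalIntegral_power_bounds hT (hν j) hf2 hfm).1
      rwa [intervalIntegral.integral_of_le hT.le] at h1
    -- the scalar dissipation is dominated by the lift's, a.e. in time
    have hGF : ∀ T, 0 < T → ∀ᵐ t ∂(volume.restrict (Ioc 0 T)), G t ≤ F t := by
      intro T hT
      have hLH := hLHu T hT
      have hfin : ∀ᵐ t ∂(volume.restrict (Ioc 0 T)),
          eGradNormSq (twoHalf (v j t) (θ' j t)) < ∞ := by
        rw [← restrict_Ioo_eq_restrict_Ioc]
        exact ae_lt_top' hLH.aemeasurable_eGradNormSq hLH.lintegral_eGradNormSq_lt_top.ne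
      filter_upwards [hfin, ae_restrict_mem measurableSet_Ioc, hae j T hT] with t ht htmem hteq
      have hvI : Integrable (v j t) volume := (hv2 j t htmem.1.le).integrable one_le_two
      have hθI : Integrable (θ' j t) volume := (hθ'2 j t htmem.1.le).integrable one_le_two
      have hle : eScalarGradNormSq (θ' j t) ≤ eGradNormSq (twoHalf (v j t) (θ' j t)) := by
        rw [eGradNormSq_twoHalf hvI hθI]
        exact le_add_self
      have hcongr : eScalarGradNormSq (θ j t) = eScalarGradNormSq (θ' j t) :=
        eScalarGradNormSq_congr_ae hteq.symm
      simp only [hF, hG]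
      rw [hcongr]
      exact mul_le_mul_of_nonneg_left (ENNReal.toReal_mono ht.ne hle) (hν j).le
    -- hence so are the running means, eventually
    have hmono : ∀ᶠ T in atTop, timeMean G T ≤ timeMean F T := by
      filter_upwards [eventually_gt_atTop (0 : ℝ)] with T hT
      exact timeMean_mono_ae hT.le hF0 (hFi T hT) (hGF T hT)
    calc ε ≤ longTimeAvgSup G := hεle j
      _ ≤ longTimeAvgSup F :=
          limsup_le_limsup hmono (isCoboundedUnder_le_timeMean_of_nonneg hG0) hFb
      _ = meanDissipation (ν j) (fun t => twoHalf (v j t) (θ' j t)) := rfl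

end Summit.AnomalousDissipation.AnomalousDissipation.Theorems

end
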